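import Summits.AtomisticToContinuum.BoseEinsteinCondensation.Theorems.BECGroundStateSOSPeriodicIRBoundFsumDefs
import Summits.AtomisticToContinuum.BoseEinsteinCondensation.Theorems.BECGroundStateSOSPeriodicIRBoundWFFormBounds2
import Summits.AtomisticToContinuum.BoseEinsteinCondensation.Theorems.BECGroundStateSOSPeriodicIRBoundWFKinematics
import Summits.AtomisticToContinuum.BoseEinsteinCondensation.Theorems.BECGroundStateSOSPeriodicIRBoundWFPolar
import HarnessLib

/-!
# Crux `PeriodicIRBound` (stmt-AtomisticToContinuum-3972), line `fsum-phase-pencil`, stub S2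
# `stub_phaseConeBlock` — part 5: regularity and form bounds of the phase quadrature `U_kΨ`

`U_kΨ = (a_k†a₀ − a₀†a₋ₖ)Ψ` (`phaseUp`, via `transfer L a b = a†(φ_a) a(φ_b) = modeCr ∘ modeAn` on `n + 1` particles)
is a core function when `Ψ` is (`WF.isCore_modeCr ∘ WF.isCore_modeAn`, closedness under subtraction), with
`𝓔_w[U_kΨ], ‖U_kΨ‖² ≤ C(n, L, k, w)·D` whenever `𝓔_w[Ψ], ‖Ψ‖² ≤ D` (`WF.qform_modeCr_le`, `WF.qform_modeAn_le`,
`‖a†Φ‖² ≤ (n+1)‖Φ‖²`, `‖a_bΨ‖² = n_b(Ψ) ≤ (n+1)‖Ψ‖²`), and `𝓔_w[U_kΨ] < ∞` when `𝓔_w[Ψ] < ∞`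
(registered by-product sub-goal `stub_fsumConeTransfer`). Also `𝓔_w[f − g] ≤ 2𝓔_w[f] + 2𝓔_w[g]`.
-/

noncomputable section

open MeasureTheory Filter
open scoped ENNReal NNReal ComplexConjugate BigOperators

namespace Summit.AtomisticToContinuum.BoseEinsteinCondensation.Cruxes.PeriodicIRBound.FsumPhasePencil

open Literature.MathematicalPhysics.QuantumManyBody.BoseGas
open Summit.AtomisticToContinuum.BoseEinsteinCondensation.Cruxes.PeriodicIRBound.LinearPhFloorWagner.WF

variable {M n : ℕ} {L : ℝ}

/-! ## Differences of cores -/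

section Sub

variable {f g : Config M → ℂ}

/-- `|a − b|² ≤ 2|a|² + 2|b|²` in `ℝ≥0∞`. [folklore] -/
theorem coe_nnnorm_sub_sq_le (a b : ℂ) :
    ((‖a - b‖₊ : ℝ≥0∞)) ^ 2 ≤ 2 * ((‖a‖₊ : ℝ≥0∞)) ^ 2 + 2 * ((‖b‖₊ : ℝ≥0∞)) ^ 2 := by
  have h := coe_nnnorm_add_sq_le a (-b)
  rwa [← sub_eq_add_neg, nnnorm_neg] at h

/-- `|∇(f − g)|² ≤ 2|∇f|² + 2|∇g|²` pointwise. [folklore] -/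
theorem kineticDensity_sub_le {X : Config M} (hf : DifferentiableAt ℝ f X) (hg : DifferentiableAt ℝ g X) :
    kineticDensity (fun Y => f Y - g Y) X ≤ 2 * kineticDensity f X + 2 * kineticDensity g X := by
  have hd : fderiv ℝ (fun Y => f Y - g Y) X = fderiv ℝ f X - fderiv ℝ g X := fderiv_fun_sub hf hg
  unfold kineticDensity
  rw [Finset.mul_sum, Finset.mul_sum, ← Finset.sum_add_distrib]
  refine Finset.sum_le_sum fun i _ => ?_
  rw [Finset.mul_sum, Finset.mul_sum, ← Finset.sum_add_distrib]
  refine Finset.sum_le_sum fun c _ => ?_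
  rw [hd, FunLike.coe_sub, Pi.sub_apply]
  exact coe_nnnorm_sub_sq_le _ _

/-- `‖f − g‖² ≤ 2‖f‖² + 2‖g‖²`. [folklore] -/
theorem normSq_sub_le (L : ℝ) (hf : Measurable f) (g : Config M → ℂ) :
    normSq L (fun X => f X - g X) ≤ 2 * normSq L f + 2 * normSq L g := by
  unfold normSq
  rw [← lintegral_const_mul _ (hf.nnnorm.coe_nnreal_ennreal.pow_const _),
    ← lintegral_const_mul' _ _ ENNReal.ofNat_ne_top,
    ← lintegral_add_left ((hf.nnnorm.coe_nnreal_ennreal.pow_const _).const_mul _)]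
  exact lintegral_mono fun X => coe_nnnorm_sub_sq_le (f X) (g X)

/-- `𝓔_w[f − g] ≤ 2𝓔_w[f] + 2𝓔_w[g]` for differentiable `f, g` (measurable `w`). [folklore] -/
theorem qform_sub_le {w : ℝ → ℝ≥0∞} (hw : Measurable w) (L : ℝ) (hf : Differentiable ℝ f) (hg : Differentiable ℝ g) :
    qform w L (fun X => f X - g X) ≤ 2 * qform w L f + 2 * qform w L g := by
  unfold qform
  have hmeas : Measurable fun X => kineticDensity f X + periodicInteraction w L X * ((‖f X‖₊ : ℝ≥0∞)) ^ 2 :=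
    (measurable_kineticDensity_fb f).add ((measurable_periodicInteraction_wf hw L).mul
      (hf.continuous.measurable.nnnorm.coe_nnreal_ennreal.pow_const _))
  rw [← lintegral_const_mul _ hmeas, ← lintegral_const_mul' _ _ ENNReal.ofNat_ne_top,
    ← lintegral_add_left (hmeas.const_mul _)]
  refine lintegral_mono fun X => ?_
  calc kineticDensity (fun Y => f Y - g Y) X + periodicInteraction w L X * ((‖f X - g X‖₊ : ℝ≥0∞)) ^ 2
      ≤ (2 * kineticDensity f X + 2 * kineticDensity g X) + periodicInteraction w L X *
          (2 * ((‖f X‖₊ : ℝ≥0∞)) ^ 2 + 2 * ((‖g X‖₊ : ℝ≥0∞)) ^ 2) :=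
        add_le_add (kineticDensity_sub_le (hf X) (hg X)) (mul_le_mul_right (coe_nnnorm_sub_sq_le _ _) _)
    _ = _ := by ring

end Sub

/-! ## The one-body lift `transfer L a b = a†(φ_a) a(φ_b)` and `U_k` -/

section Transfer

/-- `‖a†(φ_a)Φ‖² ≤ (n+1)‖Φ‖²` for a continuous `n`-body `Φ` (Cauchy–Schwarz on the `n+1` terms). [folklore] -/
theorem normSq_modeCr_le (hL : 0 < L) (a : Fin 3 → ℤ) {Φ : Config n → ℂ} (hΦ : Continuous Φ) :
    normSq L (modeCr (planeWaveMode L a) Φ) ≤ (n + 1 : ℝ≥0∞) * normSq L Φ := by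
  have hG : Measurable fun Y : Config n => ((‖Φ Y‖₊ : ℝ≥0∞)) ^ 2 :=
    hΦ.measurable.nnnorm.coe_nnreal_ennreal.pow_const _
  have hL3 : ENNReal.ofReal L ^ 3 ≠ 0 := pow_ne_zero _ (ENNReal.ofReal_pos.2 hL).ne'
  have hL3' : ENNReal.ofReal L ^ 3 ≠ ⊤ := ENNReal.pow_ne_top ENNReal.ofReal_ne_top
  have hmeas : ∀ j : Fin (n + 1), Measurable (fun X : Config (n + 1) => ((‖Φ (j.removeNth X)‖₊ : ℝ≥0∞)) ^ 2) :=
    fun j => hG.comp (continuous_removeNth j).measurable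
  unfold normSq
  calc ∫⁻ X in cellN (n + 1) L, ((‖modeCr (planeWaveMode L a) Φ X‖₊ : ℝ≥0∞)) ^ 2
      ≤ ∫⁻ X in cellN (n + 1) L, (ENNReal.ofReal L ^ 3)⁻¹ *
          ∑ j : Fin (n + 1), ((‖Φ (j.removeNth X)‖₊ : ℝ≥0∞)) ^ 2 :=
        lintegral_mono fun X => nnnorm_modeCr_sq_le hL a Φ X
    _ = (ENNReal.ofReal L ^ 3)⁻¹ * ∑ j : Fin (n + 1), ENNReal.ofReal L ^ 3 *
          ∫⁻ Y in cellN n L, ((‖Φ Y‖₊ : ℝ≥0∞)) ^ 2 := by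
        rw [lintegral_const_mul' _ _ (ENNReal.inv_ne_top.2 hL3), lintegral_finsetSum _ fun j _ => hmeas j]
        congr 1
        exact Finset.sum_congr rfl fun j _ => lintegral_cellN_comp_removeNth hG j
    _ = (n + 1 : ℝ≥0∞) * ∫⁻ Y in cellN n L, ((‖Φ Y‖₊ : ℝ≥0∞)) ^ 2 := by
        rw [Finset.sum_const, Finset.card_univ, Fintype.card_fin, nsmul_eq_mul, mul_left_comm,
          ← mul_assoc (ENNReal.ofReal L ^ 3)⁻¹, ENNReal.inv_mul_cancel hL3 hL3', one_mul, Nat.cast_succ]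

/-- `transfer L a b Ψ` is a core function when `Ψ` is (`n + 1` particles). [folklore] -/
theorem isCore_transfer (hL : 0 < L) (a b : Fin 3 → ℤ) {Ψ : Config (n + 1) → ℂ} (hΨ : IsCore L Ψ) :
    IsCore L (transfer L a b Ψ) :=
  isCore_modeCr hL a (isCore_modeAn hL b hΨ)

/-- `‖a_bΨ‖² ≤ (n+1)‖Ψ‖²`. [folklore] -/
theorem normSq_modeAn_le (hL : 0 < L) (b : Fin 3 → ℤ) {Ψ : Config (n + 1) → ℂ} (hΨ : Continuous Ψ) :
    normSq L (modeAn L (planeWaveMode L b) Ψ) ≤ (n + 1 : ℝ≥0∞) * normSq L Ψ := by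
  rw [normSq_modeAn hL b Ψ]
  have h := cellOccupation_le_mul_normSq hL b hΨ
  push_cast at h
  exact h

/-- Form bound for the one-body lift: `𝓔_w[transfer a b Ψ] ≤ (n+1)²(1 + K_a)·D` when `𝓔_w[Ψ], ‖Ψ‖² ≤ D`,
`K_a = ‖2πa/L‖² + n‖w‖₁/L³`. [folklore] -/
theorem qform_transfer_le (hL : 0 < L) {w : ℝ → ℝ≥0∞} (hw : Measurable w) (hint : (∫⁻ x : Space, w ‖x‖) ≠ ⊤)
    (a b : Fin 3 → ℤ) {Ψ : Config (n + 1) → ℂ} (hΨ : IsCore L Ψ) {D : ℝ≥0∞} (hq : qform w L Ψ ≤ D)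
    (hn : normSq L Ψ ≤ D) :
    qform w L (transfer L a b Ψ) ≤ (n + 1 : ℝ≥0∞) * ((n + 1 : ℝ≥0∞) *
      (1 + ENNReal.ofReal (‖latticeVec (2 * Real.pi / L) a‖ ^ 2 + n * (∫⁻ x : Space, w ‖x‖).toReal / L ^ 3))) * D := by
  have h1 := qform_modeCr_le hL hw hint a (isCore_modeAn hL b hΨ)
  have h2 : qform w L (modeAn L (planeWaveMode L b) Ψ) ≤ (n + 1 : ℝ≥0∞) * D :=
    (qform_modeAn_le hL hw b hΨ).trans (mul_le_mul_right hq _)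
  have h3 : normSq L (modeAn L (planeWaveMode L b) Ψ) ≤ (n + 1 : ℝ≥0∞) * D :=
    (normSq_modeAn_le hL b hΨ.contDiff.continuous).trans (mul_le_mul_right hn _)
  calc qform w L (transfer L a b Ψ)
      ≤ (n + 1 : ℝ≥0∞) * ((n + 1 : ℝ≥0∞) * D +
          ENNReal.ofReal (‖latticeVec (2 * Real.pi / L) a‖ ^ 2 + n * (∫⁻ x : Space, w ‖x‖).toReal / L ^ 3) *
            ((n + 1 : ℝ≥0∞) * D)) := h1.trans (by gcongr)
    _ = _ := by ring

/-- `𝓔_w[transfer a b Ψ] < ∞` for a core `Ψ` with finite form. [folklore] -/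
theorem qform_transfer_ne_top (hL : 0 < L) {w : ℝ → ℝ≥0∞} (hw : Measurable w) (hint : (∫⁻ x : Space, w ‖x‖) ≠ ⊤)
    (a b : Fin 3 → ℤ) {Ψ : Config (n + 1) → ℂ} (hΨ : IsCore L Ψ) (hq : qform w L Ψ ≠ ⊤) :
    qform w L (transfer L a b Ψ) ≠ ⊤ := by
  have hn1 : (n + 1 : ℝ≥0∞) ≠ ⊤ := by simp
  have hmax : max (qform w L Ψ) (normSq L Ψ) ≠ ⊤ :=
    (max_lt hq.lt_top (lintegral_cellN_sq_lt_top L hΨ.contDiff.continuous)).ne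
  exact ne_top_of_le_ne_top (ENNReal.mul_ne_top (ENNReal.mul_ne_top hn1 (ENNReal.mul_ne_top hn1
    (ENNReal.add_ne_top.2 ⟨ENNReal.one_ne_top, ENNReal.ofReal_ne_top⟩))) hmax)
    (qform_transfer_le hL hw hint a b hΨ (le_max_left _ _) (le_max_right _ _))

/-- `‖transfer a b Ψ‖² ≤ (n+1)²·D` when `‖Ψ‖² ≤ D`. [folklore] -/
theorem normSq_transfer_le (hL : 0 < L) (a b : Fin 3 → ℤ) {Ψ : Config (n + 1) → ℂ} (hΨ : Continuous Ψ)
    {D : ℝ≥0∞} (hn : normSq L Ψ ≤ D) :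
    normSq L (transfer L a b Ψ) ≤ (n + 1 : ℝ≥0∞) * (n + 1 : ℝ≥0∞) * D :=
  calc normSq L (transfer L a b Ψ) ≤ (n + 1 : ℝ≥0∞) * normSq L (modeAn L (planeWaveMode L b) Ψ) :=
        normSq_modeCr_le hL a (continuous_modeAn L (continuous_planeWaveMode L b) hΨ)
    _ ≤ (n + 1 : ℝ≥0∞) * ((n + 1 : ℝ≥0∞) * D) :=
        mul_le_mul_right ((normSq_modeAn_le hL b hΨ).trans (mul_le_mul_right hn _)) _
    _ = _ := by ring

/-- `U_kΨ` is a core function when `Ψ` is. [folklore] -/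
theorem isCore_phaseUp (hL : 0 < L) (k : Fin 3 → ℤ) {Ψ : Config (n + 1) → ℂ} (hΨ : IsCore L Ψ) :
    IsCore L (phaseUp L k Ψ) :=
  have hf := isCore_transfer hL k 0 hΨ
  have hg := isCore_transfer hL 0 (-k) hΨ
  ⟨hf.contDiff.sub hg.contDiff, fun X i c => by simp only [phaseUp, hf.periodic X i c, hg.periodic X i c],
    fun σ X => by simp only [phaseUp, hf.symm σ X, hg.symm σ X]⟩

/-- Form bound for `U_kΨ`: `𝓔_w[U_kΨ] ≤ C_U·D` when `𝓔_w[Ψ], ‖Ψ‖² ≤ D`. [folklore] -/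
theorem qform_phaseUp_le (hL : 0 < L) {w : ℝ → ℝ≥0∞} (hw : Measurable w) (hint : (∫⁻ x : Space, w ‖x‖) ≠ ⊤)
    (k : Fin 3 → ℤ) {Ψ : Config (n + 1) → ℂ} (hΨ : IsCore L Ψ) {D : ℝ≥0∞} (hq : qform w L Ψ ≤ D)
    (hn : normSq L Ψ ≤ D) :
    qform w L (phaseUp L k Ψ) ≤
      (2 * ((n + 1 : ℝ≥0∞) * ((n + 1 : ℝ≥0∞) *
          (1 + ENNReal.ofReal (‖latticeVec (2 * Real.pi / L) k‖ ^ 2 + n * (∫⁻ x : Space, w ‖x‖).toReal / L ^ 3)))) +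
        2 * ((n + 1 : ℝ≥0∞) * ((n + 1 : ℝ≥0∞) *
          (1 + ENNReal.ofReal (‖latticeVec (2 * Real.pi / L) 0‖ ^ 2 + n * (∫⁻ x : Space, w ‖x‖).toReal / L ^ 3))))) *
        D := by
  have hd₁ := (isCore_transfer hL k 0 hΨ).contDiff.differentiable one_ne_zero
  have hd₂ := (isCore_transfer hL 0 (-k) hΨ).contDiff.differentiable one_ne_zero
  calc qform w L (phaseUp L k Ψ) ≤ 2 * qform w L (transfer L k 0 Ψ) + 2 * qform w L (transfer L 0 (-k) Ψ) :=
        qform_sub_le hw L hd₁ hd₂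
    _ ≤ 2 * ((n + 1 : ℝ≥0∞) * ((n + 1 : ℝ≥0∞) *
          (1 + ENNReal.ofReal (‖latticeVec (2 * Real.pi / L) k‖ ^ 2 + n * (∫⁻ x : Space, w ‖x‖).toReal / L ^ 3))) * D) +
        2 * ((n + 1 : ℝ≥0∞) * ((n + 1 : ℝ≥0∞) *
          (1 + ENNReal.ofReal (‖latticeVec (2 * Real.pi / L) 0‖ ^ 2 + n * (∫⁻ x : Space, w ‖x‖).toReal / L ^ 3))) * D) :=
        add_le_add (mul_le_mul_right (qform_transfer_le hL hw hint k 0 hΨ hq hn) _)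
          (mul_le_mul_right (qform_transfer_le hL hw hint 0 (-k) hΨ hq hn) _)
    _ = _ := by ring

/-- `𝓔_w[U_kΨ] < ∞` for a core `Ψ` with finite form. [folklore] -/
theorem qform_phaseUp_ne_top (hL : 0 < L) {w : ℝ → ℝ≥0∞} (hw : Measurable w) (hint : (∫⁻ x : Space, w ‖x‖) ≠ ⊤)
    (k : Fin 3 → ℤ) {Ψ : Config (n + 1) → ℂ} (hΨ : IsCore L Ψ) (hq : qform w L Ψ ≠ ⊤) :
    qform w L (phaseUp L k Ψ) ≠ ⊤ :=
  ne_top_of_le_ne_top (ENNReal.add_ne_top.2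
    ⟨ENNReal.mul_ne_top ENNReal.ofNat_ne_top (qform_transfer_ne_top hL hw hint k 0 hΨ hq),
      ENNReal.mul_ne_top ENNReal.ofNat_ne_top (qform_transfer_ne_top hL hw hint 0 (-k) hΨ hq)⟩)
    (qform_sub_le hw L ((isCore_transfer hL k 0 hΨ).contDiff.differentiable one_ne_zero)
      ((isCore_transfer hL 0 (-k) hΨ).contDiff.differentiable one_ne_zero))

/-- `‖U_kΨ‖² ≤ 4(n+1)²·D` when `‖Ψ‖² ≤ D`. [folklore] -/
theorem normSq_phaseUp_le (hL : 0 < L) (k : Fin 3 → ℤ) {Ψ : Config (n + 1) → ℂ} (hΨ : IsCore L Ψ) {D : ℝ≥0∞}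
    (hn : normSq L Ψ ≤ D) : normSq L (phaseUp L k Ψ) ≤ 4 * ((n + 1 : ℝ≥0∞) * (n + 1 : ℝ≥0∞)) * D := by
  have hc := hΨ.contDiff.continuous
  calc normSq L (phaseUp L k Ψ) ≤ 2 * normSq L (transfer L k 0 Ψ) + 2 * normSq L (transfer L 0 (-k) Ψ) :=
        normSq_sub_le L (isCore_transfer hL k 0 hΨ).contDiff.continuous.measurable _
    _ ≤ 2 * ((n + 1 : ℝ≥0∞) * (n + 1 : ℝ≥0∞) * D) + 2 * ((n + 1 : ℝ≥0∞) * (n + 1 : ℝ≥0∞) * D) :=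
        add_le_add (mul_le_mul_right (normSq_transfer_le hL k 0 hc hn) _)
          (mul_le_mul_right (normSq_transfer_le hL 0 (-k) hc hn) _)
    _ = _ := by ring

end Transfer

/-! ## Registered headline -/

/-- **Registered by-product sub-goal `stub_fsumConeTransfer`** (line `fsum-phase-pencil`, helper of S2
`stub_phaseConeBlock`): `U_kΨ` is a core function with finite form whenever `Ψ` is (`isCore_phaseUp`,
`qform_phaseUp_ne_top`). [folklore] -/
theorem stub_fsumConeTransfer : ∀ {n : ℕ} {L : ℝ}, 0 < L → ∀ {w : ℝ → ℝ≥0∞}, Measurable w → (∫⁻ x : Space, w ‖x‖) ≠ ⊤ → ∀ (k : Fin 3 → ℤ) {Ψ : Config (n + 1) → ℂ}, IsCore L Ψ → qform w L Ψ ≠ ⊤ → IsCore L (phaseUp L k Ψ) ∧ qform w L (phaseUp L k Ψ) ≠ ⊤ :=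
  fun hL _ hw hint k _ hΨ hq => ⟨isCore_phaseUp hL k hΨ, qform_phaseUp_ne_top hL hw hint k hΨ hq⟩


end Summit.AtomisticToContinuum.BoseEinsteinCondensation.Cruxes.PeriodicIRBound.FsumPhasePencil

end
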